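import Literature.NumberTheory.Sieve.FriedlanderIwaniecPrimesJacobiKubota
import HarnessLib

/-!
# Friedlander–Iwaniec, *The polynomial `X² + Y⁴` captures its primes*, §17: Lemma 17.1 (the symbol `((z₂/z₁)/|Δ|)` by reciprocity)

Family `parity` (Line A of the FI `a² + b⁴` completion, node (vi): §17, the transformations of
`W(β)`). Source: J. Friedlander, H. Iwaniec, Ann. of Math. (2) 148 (1998), 945–1040
[FriedlanderIwaniecAnnals1998] (= arXiv:math/9811185), §17 "Transformations of `W(β)`", Lemma 17.1
(arXiv pp. 66–67). After switching `d` into the complementary divisor of `|Δ|/4` in the large-moduli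
part `W(β)` of the main term `T(β)` ((10.13), (10.17)), the real character `((z₂/z₁)/d)` of the
rational class `z₂/z₁ (mod d)` becomes `((z₂/z₁)/|Δ|d)` ((17.1)), and its `|Δ|`-part is computed by
the quadratic reciprocity law:

"LEMMA 17.1. Assuming (17.2)–(17.4) [`(z₁, z̄₁) = (z₂, z̄₂) = (z₁, z₂) = 1`; `z₁ ≡ z₂ (mod 8)`;
`0 < r₁r₂ ≡ 1 (mod 8)`] we have (17.5) `((z₂/z₁)/|Δ|) = (s₁/|r₁|)(s₂/|r₂|)` where
`Δ = Δ(z₁, z₂) = Im z̄₁z₂ = r₁s₂ - r₂s₁` for `z₁ = r₁ + is₁` and `z₂ = r₂ + is₂`."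

This is what turns `β_z` into `β'_z = i^{(r-1)/2}(s/|r|)β_z` ((17.8)), i.e. attaches the
Jacobi–Kubota symbol `[z]` ((17.16), tree: `jacobiKubota`) whose oscillation is the source of the
cancellation in `S^k_χ(β')` (Proposition 17.2, tree: `FriedlanderIwaniec1998_prop172`).

## What is here (everything PROVED; no definitions, no named facts)

* `jacobiSym_eq_jacobiSym_ordCompl_two` — at a modulus `m ≡ 1 (mod 8)`, `(E/m) = (E'/m)` for the odd
  part `E'` of `|E|` (the remark in the printed proof on the power of `2` and the convention (8.15)).
* `jacobiSym_lemma171_core` — the computation of the printed proof in the coordinates `r₁ = ρu₁`,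
  `r₂ = ρu₂`, `(u₁, u₂) = 1`.
* `jacobiSym_norm_mul_re_ordCompl_det` — **Lemma 17.1, arithmetic form**:
  `(|z₁|²(r₁r₂ + s₁s₂) / Δ') = (s₁/|r₁|)(s₂/|r₂|)`, `Δ'` the odd part of `|Δ|` (the symbol at the
  even modulus `|Δ|` is read with the convention (8.15) of the source, `(a/d) = (a/d')`);
* `jacobiSym_ratio_ordCompl_det` — **Lemma 17.1 as printed**: `(a/Δ') = (s₁/|r₁|)(s₂/|r₂|)` for the
  rational class `a` with `z₂ ≡ a z₁ (mod Δ')` (tree vocabulary of §6/§8: pairs `(r, s)`,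
  `Δ = det2 z₁ z₂ = r₁s₂ - r₂s₁` [`…Lemma51`], the ratio `a` as in `exists_ratio_mod_det`
  [`…CongrExpSum`, (6.6)]);
* `jacobiSym_norm_mul_re_star_mul` — the same for `z₁, z₂ : ℤ[i]` (`Δ = Im(z̄₁z₂)`,
  `r₁r₂ + s₁s₂ = Re(z̄₁z₂)`, `|z₁|² = N z₁`);
* `isCoprime_norm_im_star_mul`, `int_gcd_norm_ordCompl_im_star_mul` — (17.2)
  `(z₁, z̄₁) = (z₁, z₂) = 1` implies `(N z₁, Δ) = 1`, and `jacobiSym_norm_mul_re_star_mul_of_isCoprime` —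
  Lemma 17.1 under the printed hypotheses (17.2)–(17.4) (plus `Re zᵢ` odd and `Δ ≠ 0`).

Hypotheses actually used (all implied by (17.2)–(17.4) and the support of `β_z`, §5): `r₁, r₂` odd,
`(r₁, s₁) = (r₂, s₂) = 1`, `r₁ ≡ r₂ (mod 8)`, `r₁r₂ > 0`, `(|z₁|², Δ') = 1` (a consequence of
`(z₁, z̄₁) = (z₁, z₂) = 1`: a Gaussian prime dividing `z₁` and `Δ` divides `z̄₁z₂`), and `Δ ≠ 0`.
The evenness of `s₁, s₂` and `s₁ ≡ s₂ (mod 8)` are not needed.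

## The proof (as printed, p. 66–67)

`z₂/z₁ = (r₁r₂ + s₁s₂ + iΔ)|z₁|⁻²`, so `((z₂/z₁)/Δ') = (|z₁|²/Δ')((r₁r₂ + s₁s₂)/Δ')`. Put `r₁ = ρu₁`,
`r₂ = ρu₂`, `(u₁, u₂) = 1`; then `Δ = ρE`, `E = u₁s₂ - u₂s₁`, `(u₁u₂, E) = 1`, `u₁u₂ ≡ 1 (mod 8)`,
`u₁u₂ > 0`. Modulo `ρ` the argument is `≡ s₁² · s₁s₂`, giving `(s₁s₂/ρ)`. Modulo `E'`, the identity
`(ρ²u₁u₂ + s₁s₂)u₁² = u₁u₂|z₁|² + u₁s₁E` gives `(u₁u₂/E')`, which by the reciprocity law (17.6)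
[tree: `jacobiSym_natAbs_mul_jacobiSym_natAbs`, with `(a, b)_∞ = 1` as `E' > 0` and the sign `+1` as
`u₁u₂ ≡ 1 (mod 4)`] equals `(E'/u₁u₂) = (E/u₁u₂)` (`(2/u₁u₂) = (-1/u₁u₂) = 1`)
`= (-u₂s₁/|u₁|)(u₁s₂/|u₂|) = ε (s₁/|u₁|)(s₂/|u₂|)` with `ε = (-u₂/|u₁|)(u₁/|u₂|) = 1` by (17.6)
again (`u₁ ≡ u₂ (mod 4)`, same sign). Finally `(s₁s₂/ρ)(s₁/|u₁|)(s₂/|u₂|) = (s₁/|r₁|)(s₂/|r₂|)`.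

## References

* J. Friedlander, H. Iwaniec, Ann. of Math. (2) 148 (1998), 945–1040, §8 (8.15); §17 (17.1)–(17.8),
  Lemma 17.1. [FriedlanderIwaniecAnnals1998]

## Tree / Mathlib

Tree: `hilbertInfty`, `recipSign`, `jacobiSym_natAbs_mul_jacobiSym_natAbs` ((17.6)),
`jacobiSym_natAbs_eq_of_dvd_sub`, `eq_mul_of_sq_eq_one`, `hilbertInfty_of_pos_right`
(`FriedlanderIwaniecPrimesJacobiKubota`), `int_gcd_natAbs_cast` (`…DirichletSymbol`). Mathlib:
`jacobiSym.mul_left`, `jacobiSym.mul_right'`, `jacobiSym.sq_one`, `jacobiSym.sq_one'`,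
`jacobiSym.at_two`, `jacobiSym.at_neg_one`, `ZMod.χ₈_nat_eq_if_mod_eight`, `ZMod.χ₄_nat_eq_if_mod_four`,
`Nat.ordProj_mul_ordCompl_eq_self`, `Nat.ordCompl_mul`, `Nat.not_dvd_ordCompl`, `Int.gcd_div_gcd_div_gcd`,
`IsCoprime.add_mul_left_right`, `IsCoprime.of_isCoprime_of_dvd_right`.
-/

namespace Literature.NumberTheory.Sieve.FriedlanderIwaniecPrimes

open scoped NumberTheorySymbols

/-! ### Odd squares, moduli `≡ 1 (mod 8)`, odd parts -/

/-- An odd square is `≡ 1 (mod 8)`. [folklore] -/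
private theorem sq_emod_eight_of_odd {n : ℤ} (hn : Odd n) : n ^ 2 % 8 = 1 := by
  have h2 : n % 2 = 1 := Int.odd_iff.mp hn
  have h8 : n % 8 = 1 ∨ n % 8 = 3 ∨ n % 8 = 5 ∨ n % 8 = 7 := by omega
  have : n ^ 2 % 8 = (n % 8) * (n % 8) % 8 := by rw [sq, Int.mul_emod]
  rw [this]; rcases h8 with h | h | h | h <;> rw [h] <;> norm_num

/-- `J(-1 | m) = 1` for `m ≡ 1 (mod 8)`. [folklore] -/
private theorem jacobiSym_neg_one_eq_one {m : ℕ} (hm : m % 8 = 1) : J(-1 | m) = 1 := by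
  have hodd : Odd m := Nat.odd_iff.mpr (by omega)
  rw [jacobiSym.at_neg_one hodd, ZMod.χ₄_nat_eq_if_mod_four, if_neg (by omega), if_pos (by omega)]

/-- `J(2 | m) = 1` for `m ≡ 1 (mod 8)`. [folklore] -/
private theorem jacobiSym_two_eq_one {m : ℕ} (hm : m % 8 = 1) : J(2 | m) = 1 := by
  have hodd : Odd m := Nat.odd_iff.mpr (by omega)
  rw [jacobiSym.at_two hodd, ZMod.χ₈_nat_eq_if_mod_eight, if_neg (by omega), if_pos (Or.inl hm)]

/-- At a modulus `m ≡ 1 (mod 8)` the Jacobi symbol of `E ≠ 0` only depends on the odd part of `|E|`: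
`(E / m) = (E' / m)`, `|E| = 2^ν E'` ("one has to pull out from the determinant the whole power of `2`
before application of (17.6) and install it back after at no cost because of … `u₁u₂ ≡ 1 (mod 8)`").
[cite: FriedlanderIwaniecAnnals1998, Lemma 17.1 (proof)] -/
theorem jacobiSym_eq_jacobiSym_ordCompl_two {m : ℕ} (hm : m % 8 = 1) {E : ℤ} (hE : E ≠ 0) :
    J(E | m) = J(((ordCompl[2] E.natAbs : ℕ) : ℤ) | m) := by
  have hdec : E = E.sign * (2 : ℤ) ^ (E.natAbs.factorization 2) * ((ordCompl[2] E.natAbs : ℕ) : ℤ) := by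
    have h1 : (E.natAbs : ℤ) = (2 : ℤ) ^ (E.natAbs.factorization 2) * ((ordCompl[2] E.natAbs : ℕ) : ℤ) := by
      exact_mod_cast (Nat.ordProj_mul_ordCompl_eq_self E.natAbs 2).symm
    calc E = E.sign * (E.natAbs : ℤ) := (Int.sign_mul_natAbs E).symm
      _ = _ := by rw [h1, mul_assoc]
  conv_lhs => rw [hdec]
  rw [jacobiSym.mul_left, jacobiSym.mul_left, jacobiSym.pow_left, jacobiSym_two_eq_one hm, one_pow,
    mul_one]
  rcases lt_or_gt_of_ne hE with h | h
  · rw [Int.sign_eq_neg_one_of_neg h, jacobiSym_neg_one_eq_one hm, one_mul]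
  · rw [Int.sign_eq_one_of_pos h, jacobiSym.one_left, one_mul]

/-! ### Lemma 17.1 -/

/-- The computation of Lemma 17.1 in the coordinates `r₁ = ρu₁`, `r₂ = ρu₂`, `(u₁, u₂) = 1` of its
proof: `(|z₁|²(r₁r₂ + s₁s₂) / ρE') = (s₁/|r₁|)(s₂/|r₂|)`, `E = u₁s₂ - u₂s₁`, `E'` the odd part of `|E|`.
[cite: FriedlanderIwaniecAnnals1998, Lemma 17.1 (proof)] -/
theorem jacobiSym_lemma171_core {ρ : ℕ} {u₁ u₂ s₁ s₂ : ℤ} (hρ : Odd (ρ : ℤ)) (hu₁ : Odd u₁)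
    (hu₂ : Odd u₂) (hu12 : Int.gcd u₁ u₂ = 1) (h₁ : Int.gcd ((ρ : ℤ) * u₁) s₁ = 1)
    (h₂ : Int.gcd ((ρ : ℤ) * u₂) s₂ = 1) (h8 : u₁ * u₂ % 8 = 1) (h4 : 4 ∣ u₁ - u₂)
    (hpos : 0 < u₁ * u₂) (hE0 : u₁ * s₂ - u₂ * s₁ ≠ 0)
    (hcop : Int.gcd (((ρ : ℤ) * u₁) ^ 2 + s₁ ^ 2)
      ((ordCompl[2] (u₁ * s₂ - u₂ * s₁).natAbs : ℕ) : ℤ) = 1) :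
    J((((ρ : ℤ) * u₁) ^ 2 + s₁ ^ 2) * ((ρ : ℤ) * u₁ * ((ρ : ℤ) * u₂) + s₁ * s₂) |
        ρ * ordCompl[2] (u₁ * s₂ - u₂ * s₁).natAbs) =
      J(s₁ | ρ * u₁.natAbs) * J(s₂ | ρ * u₂.natAbs) := by
  -- names
  set N : ℤ := ((ρ : ℤ) * u₁) ^ 2 + s₁ ^ 2 with hN
  set E : ℤ := u₁ * s₂ - u₂ * s₁ with hE
  set E' : ℕ := ordCompl[2] E.natAbs with hE'
  have hρ0 : ρ ≠ 0 := by rintro rfl; exact absurd hρ (by decide)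
  have hρZ0 : (ρ : ℤ) ≠ 0 := by exact_mod_cast hρ0
  have hEabs0 : E.natAbs ≠ 0 := Int.natAbs_ne_zero.mpr hE0
  have hE'0 : E' ≠ 0 := (Nat.ordCompl_pos 2 hEabs0).ne'
  have hE'pos : (0 : ℤ) < E' := by exact_mod_cast Nat.pos_of_ne_zero hE'0
  have hE'odd : Odd E' := by
    rw [Nat.odd_iff]
    have := Nat.not_dvd_ordCompl Nat.prime_two hEabs0
    omega
  have hE'oddZ : Odd (E' : ℤ) := by exact_mod_cast hE'odd
  have hE'dvd : (E' : ℤ) ∣ E := Int.natCast_dvd.mpr (Nat.ordCompl_dvd _ 2)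
  have hu₁0 : u₁ ≠ 0 := fun h => by rw [h, zero_mul] at hpos; exact lt_irrefl _ hpos
  have hu₂0 : u₂ ≠ 0 := fun h => by rw [h, mul_zero] at hpos; exact lt_irrefl _ hpos
  have hu₁a0 : u₁.natAbs ≠ 0 := Int.natAbs_ne_zero.mpr hu₁0
  have hu₂a0 : u₂.natAbs ≠ 0 := Int.natAbs_ne_zero.mpr hu₂0
  -- coprimalities
  have hc1 : IsCoprime ((ρ : ℤ) * u₁) s₁ := Int.isCoprime_iff_gcd_eq_one.mpr h₁
  have hc2 : IsCoprime ((ρ : ℤ) * u₂) s₂ := Int.isCoprime_iff_gcd_eq_one.mpr h₂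
  have hcu : IsCoprime u₁ u₂ := Int.isCoprime_iff_gcd_eq_one.mpr hu12
  have hu₁E : IsCoprime u₁ E := by
    have h : IsCoprime u₁ (-(u₂ * s₁)) := (hcu.mul_right hc1.of_mul_left_right).neg_right
    have e : E = -(u₂ * s₁) + u₁ * s₂ := by rw [hE]; ring
    rw [e]; exact h.add_mul_left_right s₂
  have hu₂E : IsCoprime u₂ E := by
    have h : IsCoprime u₂ (u₁ * s₂) := hcu.symm.mul_right hc2.of_mul_left_right
    have e : E = u₁ * s₂ + u₂ * (-s₁) := by rw [hE]; ring
    rw [e]; exact h.add_mul_left_right (-s₁)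
  have hu₁E' : IsCoprime u₁ (E' : ℤ) := hu₁E.of_isCoprime_of_dvd_right hE'dvd
  have hu₂E' : IsCoprime u₂ (E' : ℤ) := hu₂E.of_isCoprime_of_dvd_right hE'dvd
  have huuE' : Int.gcd (u₁ * u₂) (E' : ℤ) = 1 :=
    Int.isCoprime_iff_gcd_eq_one.mp (hu₁E'.mul_left hu₂E')
  have hNE' : Int.gcd N (E' : ℤ) = 1 := hcop
  have hs₁ρ : Int.gcd s₁ (ρ : ℤ) = 1 :=
    Int.isCoprime_iff_gcd_eq_one.mp hc1.of_mul_left_left.symm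
  -- Step A: split the modulus `ρ E'`
  rw [jacobiSym.mul_right' _ hρ0 hE'0]
  -- Step B: `(x / ρ) = (s₁ s₂ / ρ)`
  have hB : J(N * ((ρ : ℤ) * u₁ * ((ρ : ℤ) * u₂) + s₁ * s₂) | ρ) = J(s₁ * s₂ | ρ) := by
    have h := jacobiSym_natAbs_eq_of_dvd_sub (y := (ρ : ℤ))
      (x := N * ((ρ : ℤ) * u₁ * ((ρ : ℤ) * u₂) + s₁ * s₂)) (x' := s₁ ^ 2 * (s₁ * s₂))
      ⟨(ρ : ℤ) ^ 3 * u₁ ^ 3 * u₂ + (ρ : ℤ) * u₁ ^ 2 * (s₁ * s₂) + (ρ : ℤ) * s₁ ^ 2 * (u₁ * u₂), by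
        rw [hN]; ring⟩
    rw [Int.natAbs_natCast] at h
    rw [h, jacobiSym.mul_left, jacobiSym.sq_one' hs₁ρ, one_mul]
  -- Step C: `(x / E') = (u₁u₂ / E')`
  have hC : J(N * ((ρ : ℤ) * u₁ * ((ρ : ℤ) * u₂) + s₁ * s₂) | E') = J(u₁ * u₂ | E') := by
    -- `x u₁² ≡ u₁u₂ N² (mod E)`
    have hmod : J(N * ((ρ : ℤ) * u₁ * ((ρ : ℤ) * u₂) + s₁ * s₂) * u₁ ^ 2 | E') =
        J(u₁ * u₂ * N ^ 2 | E') := by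
      have h := jacobiSym_natAbs_eq_of_dvd_sub (y := (E' : ℤ))
        (x := N * ((ρ : ℤ) * u₁ * ((ρ : ℤ) * u₂) + s₁ * s₂) * u₁ ^ 2) (x' := u₁ * u₂ * N ^ 2)
        (Dvd.dvd.trans hE'dvd ⟨N * u₁ * s₁, by rw [hN, hE]; ring⟩)
      rwa [Int.natAbs_natCast] at h
    rw [jacobiSym.mul_left, jacobiSym.mul_left (u₁ * u₂), jacobiSym.sq_one' hNE',
      jacobiSym.sq_one' (Int.isCoprime_iff_gcd_eq_one.mp hu₁E'), mul_one, mul_one] at hmod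
    exact hmod
  -- Step D: reciprocity (17.6): `(u₁u₂ / E') = (E' / u₁u₂)`
  have huuodd : Odd (u₁ * u₂) := Int.odd_mul.mpr ⟨hu₁, hu₂⟩
  have hm : ((u₁ * u₂).natAbs : ℤ) = u₁ * u₂ := Int.natAbs_of_nonneg hpos.le
  have hm8 : (u₁ * u₂).natAbs % 8 = 1 := by
    have : ((u₁ * u₂).natAbs : ℤ) % 8 = 1 := by rw [hm]; exact h8
    omega
  have hD : J(u₁ * u₂ | E') = J((E' : ℤ) | (u₁ * u₂).natAbs) := by
    have h := jacobiSym_natAbs_mul_jacobiSym_natAbs huuodd hE'oddZ huuE'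
    rw [Int.natAbs_natCast, hilbertInfty_of_pos_right _ hE'pos, mul_one] at h
    have hsign : recipSign (u₁ * u₂) (E' : ℤ) = 1 := by
      rw [recipSign_def, if_neg]; omega
    rw [hsign] at h
    have hsq : J((E' : ℤ) | (u₁ * u₂).natAbs) ^ 2 = 1 :=
      jacobiSym.sq_one (by rw [int_gcd_natAbs_cast, Int.gcd_comm]; exact huuE')
    have h' : J((E' : ℤ) | (u₁ * u₂).natAbs) * J(u₁ * u₂ | E') = 1 := by rw [mul_comm]; exact h
    have := eq_mul_of_sq_eq_one hsq h'
    rw [this, mul_one]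
  -- Step E: install the power of two and the sign back: `(E' / u₁u₂) = (E / u₁u₂)`
  have hEstep : J((E' : ℤ) | (u₁ * u₂).natAbs) = J(E | (u₁ * u₂).natAbs) :=
    (jacobiSym_eq_jacobiSym_ordCompl_two hm8 hE0).symm
  -- Step F: `(E / u₁u₂) = (-u₂ s₁ / |u₁|)(u₁ s₂ / |u₂|)`
  have hF : J(E | (u₁ * u₂).natAbs) =
      J(-u₂ | u₁.natAbs) * J(s₁ | u₁.natAbs) * (J(u₁ | u₂.natAbs) * J(s₂ | u₂.natAbs)) := by
    rw [Int.natAbs_mul, jacobiSym.mul_right' _ hu₁a0 hu₂a0]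
    have h1 : J(E | u₁.natAbs) = J(-u₂ * s₁ | u₁.natAbs) :=
      jacobiSym_natAbs_eq_of_dvd_sub ⟨s₂, by rw [hE]; ring⟩
    have h2 : J(E | u₂.natAbs) = J(u₁ * s₂ | u₂.natAbs) :=
      jacobiSym_natAbs_eq_of_dvd_sub ⟨-s₁, by rw [hE]; ring⟩
    rw [h1, h2, jacobiSym.mul_left, jacobiSym.mul_left]
  -- Step G: `ε = (-u₂ / |u₁|)(u₁ / |u₂|) = 1`
  have hG : J(-u₂ | u₁.natAbs) * J(u₁ | u₂.natAbs) = 1 := by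
    have h := jacobiSym_natAbs_mul_jacobiSym_natAbs (a := u₁) (b := -u₂) hu₁ hu₂.neg
      (by rw [Int.gcd_neg]; exact hu12)
    rw [Int.natAbs_neg] at h
    have hsign : recipSign u₁ (-u₂) = 1 := by
      rw [recipSign_def, if_neg]
      have := Int.odd_iff.mp hu₁
      omega
    have hhil : hilbertInfty u₁ (-u₂) = 1 := by
      rw [hilbertInfty_def, if_neg]
      rintro ⟨ha, hb⟩
      have : u₁ * u₂ < 0 := mul_neg_of_neg_of_pos ha (by linarith)
      linarith
    rw [hsign, hhil, mul_one] at h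
    rw [mul_comm]; exact h
  -- Step H: assemble
  rw [hB, hC, hD, hEstep, hF, jacobiSym.mul_left, jacobiSym.mul_right' _ hρ0 hu₁a0,
    jacobiSym.mul_right' _ hρ0 hu₂a0]
  have e : J(-u₂ | u₁.natAbs) * J(s₁ | u₁.natAbs) * (J(u₁ | u₂.natAbs) * J(s₂ | u₂.natAbs)) =
      (J(-u₂ | u₁.natAbs) * J(u₁ | u₂.natAbs)) * (J(s₁ | u₁.natAbs) * J(s₂ | u₂.natAbs)) := by ring
  rw [e, hG, one_mul]; ring

/-- **Lemma 17.1, arithmetic form.** For `z₁ = r₁ + is₁`, `z₂ = r₂ + is₂` with `r₁, r₂` odd,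
`(r₁, s₁) = (r₂, s₂) = 1`, `r₁ ≡ r₂ (mod 8)`, `r₁r₂ > 0` ((17.2)–(17.4)), `Δ = r₁s₂ - r₂s₁ ≠ 0` and
`(|z₁|², Δ') = 1` (`Δ'` the odd part of `|Δ|`, convention (8.15)):
`(|z₁|² (r₁r₂ + s₁s₂) / Δ') = (s₁/|r₁|)(s₂/|r₂|)` — this is (17.5), as
`z₂/z₁ = (r₁r₂ + s₁s₂ + iΔ)|z₁|⁻²`. Proof as printed: `r₁ = ρu₁`, `r₂ = ρu₂`, `(u₁,u₂) = 1`;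
`(ρ²u₁u₂ + s₁s₂)u₁² = u₁u₂|z₁|² + u₁s₁(u₁s₂ - u₂s₁)`; the reciprocity law (17.6)
[tree: `jacobiSym_natAbs_mul_jacobiSym_natAbs`] twice, the power of `2` in `Δ` being harmless as
`u₁u₂ ≡ 1 (mod 8)`; `ε = (-u₂/|u₁|)(u₁/|u₂|) = 1`.
[cite: FriedlanderIwaniecAnnals1998, Lemma 17.1] -/
theorem jacobiSym_norm_mul_re_ordCompl_det {r₁ s₁ r₂ s₂ : ℤ} (hr₁ : Odd r₁) (hr₂ : Odd r₂)
    (h₁ : Int.gcd r₁ s₁ = 1) (h₂ : Int.gcd r₂ s₂ = 1) (h8 : 8 ∣ r₁ - r₂) (hpos : 0 < r₁ * r₂)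
    (hΔ0 : r₁ * s₂ - r₂ * s₁ ≠ 0)
    (hcop : Int.gcd (r₁ ^ 2 + s₁ ^ 2) ((ordCompl[2] (r₁ * s₂ - r₂ * s₁).natAbs : ℕ) : ℤ) = 1) :
    J((r₁ ^ 2 + s₁ ^ 2) * (r₁ * r₂ + s₁ * s₂) | ordCompl[2] (r₁ * s₂ - r₂ * s₁).natAbs) =
      J(s₁ | r₁.natAbs) * J(s₂ | r₂.natAbs) := by
  have hr₁0 : r₁ ≠ 0 := fun h => by rw [h, zero_mul] at hpos; exact lt_irrefl _ hpos
  obtain ⟨ρ, hρ⟩ : ∃ ρ : ℕ, Int.gcd r₁ r₂ = ρ := ⟨_, rfl⟩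
  have hρ0 : 0 < ρ := hρ ▸ Int.gcd_pos_of_ne_zero_left r₂ hr₁0
  obtain ⟨u₁, rfl⟩ : (ρ : ℤ) ∣ r₁ := hρ ▸ Int.gcd_dvd_left r₁ r₂
  obtain ⟨u₂, rfl⟩ : (ρ : ℤ) ∣ r₂ := hρ ▸ Int.gcd_dvd_right ((ρ : ℤ) * u₁) r₂
  have hu12 : Int.gcd u₁ u₂ = 1 := by
    rw [Int.gcd_mul_left, Int.natAbs_natCast] at hρ
    exact Nat.eq_of_mul_eq_mul_left hρ0 (hρ.trans (mul_one ρ).symm)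
  have hρodd : Odd (ρ : ℤ) := (Int.odd_mul.mp hr₁).1
  have hρoddN : Odd ρ := by exact_mod_cast hρodd
  have hu₁ : Odd u₁ := (Int.odd_mul.mp hr₁).2
  have hu₂ : Odd u₂ := (Int.odd_mul.mp hr₂).2
  have hpos' : 0 < u₁ * u₂ := by
    have e : (ρ : ℤ) * u₁ * ((ρ : ℤ) * u₂) = ((ρ : ℤ) ^ 2) * (u₁ * u₂) := by ring
    rw [e] at hpos
    exact (mul_pos_iff_of_pos_left (by positivity)).mp hpos
  have h8' : (8 : ℤ) ∣ u₁ - u₂ := by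
    have e : (ρ : ℤ) * u₁ - (ρ : ℤ) * u₂ = (ρ : ℤ) * (u₁ - u₂) := by ring
    rw [e] at h8
    have hc : IsCoprime (8 : ℤ) (ρ : ℤ) := by
      rw [Int.isCoprime_iff_gcd_eq_one, show (8 : ℤ) = ((8 : ℕ) : ℤ) by norm_num,
        Int.gcd_natCast_natCast]
      exact (Nat.coprime_two_left.mpr hρoddN).pow_left 3
    exact hc.dvd_of_dvd_mul_left h8
  have h84 : u₁ * u₂ % 8 = 1 ∧ (4 : ℤ) ∣ u₁ - u₂ := by
    obtain ⟨t, ht⟩ := h8'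
    refine ⟨?_, ⟨2 * t, by linarith⟩⟩
    have e : u₁ * u₂ = u₁ ^ 2 + 8 * (-(t * u₁)) := by
      have : u₂ = u₁ - 8 * t := by linarith
      rw [this]; ring
    rw [e, Int.add_mul_emod_self_left, sq_emod_eight_of_odd hu₁]
  have hΔ : (ρ : ℤ) * u₁ * s₂ - (ρ : ℤ) * u₂ * s₁ = (ρ : ℤ) * (u₁ * s₂ - u₂ * s₁) := by ring
  have hE0 : u₁ * s₂ - u₂ * s₁ ≠ 0 := by
    intro h; rw [hΔ, h, mul_zero] at hΔ0; exact hΔ0 rfl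
  have hρ2 : ¬ 2 ∣ ρ := by rw [Nat.two_dvd_ne_zero]; exact Nat.odd_iff.mp hρoddN
  have hmod : ordCompl[2] ((ρ : ℤ) * u₁ * s₂ - (ρ : ℤ) * u₂ * s₁).natAbs =
      ρ * ordCompl[2] (u₁ * s₂ - u₂ * s₁).natAbs := by
    rw [hΔ, Int.natAbs_mul, Int.natAbs_natCast, Nat.ordCompl_mul,
      (Nat.ordCompl_eq_self_iff_zero_or_not_dvd ρ Nat.prime_two).mpr (Or.inr hρ2)]
  rw [hmod] at hcop ⊢
  have hcop' : Int.gcd (((ρ : ℤ) * u₁) ^ 2 + s₁ ^ 2)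
      ((ordCompl[2] (u₁ * s₂ - u₂ * s₁).natAbs : ℕ) : ℤ) = 1 := by
    rw [Int.gcd_eq_natAbs, Int.natAbs_natCast] at hcop ⊢
    exact Nat.Coprime.coprime_mul_left_right hcop
  rw [Int.natAbs_mul, Int.natAbs_natCast, Int.natAbs_mul, Int.natAbs_natCast]
  exact jacobiSym_lemma171_core hρodd hu₁ hu₂ hu12 h₁ h₂ h84.1 h84.2 hpos' hE0 hcop'

/-- **Friedlander–Iwaniec, Lemma 17.1.** "Assuming (17.2)–(17.4) [`(z₁, z̄₁) = (z₂, z̄₂) = (z₁, z₂) = 1`,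
`z₁ ≡ z₂ (mod 8)`, `0 < r₁r₂ ≡ 1 (mod 8)`] we have (17.5) `((z₂/z₁)/|Δ|) = (s₁/|r₁|)(s₂/|r₂|)`
where `Δ = Δ(z₁, z₂) = Im z̄₁z₂ = r₁s₂ - r₂s₁` for `z₁ = r₁ + is₁` and `z₂ = r₂ + is₂`. Note that
`s₁, s₂` are even and `(r₁, s₁) = (r₂, s₂) = 1`." Here `z₂/z₁` is the rational residue class `a`
with `z₂ ≡ a z₁ (mod Δ')` (it exists as `Δ' ∣ Δ(z₁, z₂)`, cf. (6.6) [tree: `exists_ratio_mod_det`]),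
and the symbol to the even modulus `|Δ|` is the Jacobi symbol to its odd part `Δ'` (convention
(8.15)). Of the printed hypotheses exactly these are used: `r₁, r₂` odd, `(r₁, s₁) = (r₂, s₂) = 1`,
`r₁ ≡ r₂ (mod 8)`, `r₁r₂ > 0`, and `(|z₁|², Δ') = 1` (a consequence of `(z₁, z̄₁) = (z₁, z₂) = 1`);
we also assume `Δ ≠ 0`. [cite: FriedlanderIwaniecAnnals1998, Lemma 17.1] -/
theorem jacobiSym_ratio_ordCompl_det {r₁ s₁ r₂ s₂ a : ℤ} (hr₁ : Odd r₁) (hr₂ : Odd r₂)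
    (h₁ : Int.gcd r₁ s₁ = 1) (h₂ : Int.gcd r₂ s₂ = 1) (h8 : 8 ∣ r₁ - r₂) (hpos : 0 < r₁ * r₂)
    (hΔ0 : r₁ * s₂ - r₂ * s₁ ≠ 0)
    (hcop : Int.gcd (r₁ ^ 2 + s₁ ^ 2) ((ordCompl[2] (r₁ * s₂ - r₂ * s₁).natAbs : ℕ) : ℤ) = 1)
    (ha : ((ordCompl[2] (r₁ * s₂ - r₂ * s₁).natAbs : ℕ) : ℤ) ∣ r₂ - a * r₁ ∧
      ((ordCompl[2] (r₁ * s₂ - r₂ * s₁).natAbs : ℕ) : ℤ) ∣ s₂ - a * s₁) :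
    J(a | ordCompl[2] (r₁ * s₂ - r₂ * s₁).natAbs) = J(s₁ | r₁.natAbs) * J(s₂ | r₂.natAbs) := by
  set D : ℕ := ordCompl[2] (r₁ * s₂ - r₂ * s₁).natAbs with hD
  have hmain := jacobiSym_norm_mul_re_ordCompl_det hr₁ hr₂ h₁ h₂ h8 hpos hΔ0 hcop
  have h1 : J(a * (r₁ ^ 2 + s₁ ^ 2) | D) = J(r₁ * r₂ + s₁ * s₂ | D) := by
    obtain ⟨⟨k₁, hk₁⟩, ⟨k₂, hk₂⟩⟩ := ha
    have h := jacobiSym_natAbs_eq_of_dvd_sub (y := (D : ℤ)) (x := a * (r₁ ^ 2 + s₁ ^ 2))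
      (x' := r₁ * r₂ + s₁ * s₂) ⟨-(r₁ * k₁ + s₁ * k₂), by linear_combination (-r₁) * hk₁ - s₁ * hk₂⟩
    rwa [Int.natAbs_natCast] at h
  have hsq : J(r₁ ^ 2 + s₁ ^ 2 | D) ^ 2 = 1 := jacobiSym.sq_one hcop
  calc J(a | D) = J(a | D) * J(r₁ ^ 2 + s₁ ^ 2 | D) ^ 2 := by rw [hsq, mul_one]
    _ = J(a * (r₁ ^ 2 + s₁ ^ 2) | D) * J(r₁ ^ 2 + s₁ ^ 2 | D) := by rw [jacobiSym.mul_left]; ring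
    _ = J((r₁ ^ 2 + s₁ ^ 2) * (r₁ * r₂ + s₁ * s₂) | D) := by rw [h1, jacobiSym.mul_left]; ring
    _ = _ := hmain

section GaussianInt

/-- Lemma 17.1 for Gaussian integers `z₁, z₂`: `Δ(z₁, z₂) = Im z̄₁z₂`, `Re z̄₁z₂ = r₁r₂ + s₁s₂`,
`|z₁|² = N z₁`, so `(N z₁ · Re z̄₁z₂ / Δ') = (s₁/|r₁|)(s₂/|r₂|)`; with the Jacobi–Kubota data
`[z] = i^{(r-1)/2}(s/|r|)` of (17.16) [tree: `jacobiKubota`] the right side is the product of the two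
Jacobi symbols `(s₁/|r₁|)(s₂/|r₂|)`. [cite: FriedlanderIwaniecAnnals1998, Lemma 17.1] -/
theorem jacobiSym_norm_mul_re_star_mul {z₁ z₂ : GaussianInt} (hr₁ : Odd z₁.re) (hr₂ : Odd z₂.re)
    (h₁ : Int.gcd z₁.re z₁.im = 1) (h₂ : Int.gcd z₂.re z₂.im = 1) (h8 : 8 ∣ z₁.re - z₂.re)
    (hpos : 0 < z₁.re * z₂.re) (hΔ0 : (star z₁ * z₂).im ≠ 0)
    (hcop : Int.gcd z₁.norm ((ordCompl[2] (star z₁ * z₂).im.natAbs : ℕ) : ℤ) = 1) :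
    J(z₁.norm * (star z₁ * z₂).re | ordCompl[2] (star z₁ * z₂).im.natAbs) =
      J(z₁.im | z₁.re.natAbs) * J(z₂.im | z₂.re.natAbs) := by
  have him : (star z₁ * z₂).im = z₁.re * z₂.im - z₂.re * z₁.im := by
    simp only [Zsqrtd.im_mul, Zsqrtd.re_star, Zsqrtd.im_star]; ring
  have hre : (star z₁ * z₂).re = z₁.re * z₂.re + z₁.im * z₂.im := by
    simp only [Zsqrtd.re_mul, Zsqrtd.re_star, Zsqrtd.im_star]; ring
  have hnorm : z₁.norm = z₁.re ^ 2 + z₁.im ^ 2 := by rw [Zsqrtd.norm_def]; ring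
  rw [him] at hΔ0 hcop ⊢
  rw [hnorm] at hcop ⊢
  rw [hre]
  exact jacobiSym_norm_mul_re_ordCompl_det hr₁ hr₂ h₁ h₂ h8 hpos hΔ0 hcop


/-! ### The hypothesis `(|z₁|², Δ') = 1` from (17.2) -/

/-- Rational integers coprime in `ℤ[i]` are coprime in `ℤ` (a common divisor `g ≥ 0` in `ℤ` is a unit
of `ℤ[i]`, so `N g = g² = 1`). [folklore] -/
private theorem int_isCoprime_of_isCoprime_cast {a b : ℤ}
    (h : IsCoprime (a : GaussianInt) (b : GaussianInt)) : IsCoprime a b := by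
  rw [Int.isCoprime_iff_gcd_eq_one]
  set g : ℕ := Int.gcd a b with hg
  have hga : ((g : ℤ) : GaussianInt) ∣ (a : GaussianInt) :=
    (Int.castRingHom GaussianInt).map_dvd (Int.gcd_dvd_left a b)
  have hgb : ((g : ℤ) : GaussianInt) ∣ (b : GaussianInt) :=
    (Int.castRingHom GaussianInt).map_dvd (Int.gcd_dvd_right a b)
  have hu : IsUnit (((g : ℤ) : GaussianInt)) := h.isUnit_of_dvd' hga hgb
  have hn : (((g : ℤ) : GaussianInt)).norm = 1 := (Zsqrtd.norm_eq_one_iff' (by norm_num) _).mpr hu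
  rw [Zsqrtd.norm_intCast] at hn
  have : (g : ℤ) = 1 := by
    have hg0 : (0 : ℤ) ≤ g := by positivity
    nlinarith
  exact_mod_cast this

/-- `Im(z̄₁ z₂)` doubled is `z̄₁z₂ - z₁z̄₂` up to the unit `i`: `z̄₁z₂ - z₁z̄₂ = 2Δ(z₁,z₂)·i`. [folklore] -/
private theorem star_mul_sub_mul_star (z₁ z₂ : GaussianInt) :
    star z₁ * z₂ - z₁ * star z₂ = ((2 * (star z₁ * z₂).im : ℤ) : GaussianInt) * ⟨0, 1⟩ := by
  ext <;> simp only [Zsqrtd.re_sub, Zsqrtd.im_sub, Zsqrtd.re_mul, Zsqrtd.im_mul, Zsqrtd.re_star,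
    Zsqrtd.im_star, Zsqrtd.re_intCast, Zsqrtd.im_intCast] <;> ring

/-- **(17.2) ⇒ `(|z₁|², Δ) = 1`.** If `(z₁, z̄₁) = (z₁, z₂) = 1` in `ℤ[i]` then `N z₁ = z₁z̄₁` is prime
to `2Δ(z₁, z₂) = (z̄₁z₂ - z₁z̄₂)/i` (a Gaussian prime dividing `z₁` and `z̄₁z₂ - z₁z̄₂` divides `z̄₁z₂`),
hence to `Δ(z₁, z₂) = Im z̄₁z₂` and to its odd part — the coprimality hypothesis of Lemma 17.1
(`jacobiSym_norm_mul_re_star_mul`, `jacobiSym_ratio_ordCompl_det`).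
[cite: FriedlanderIwaniecAnnals1998, (17.2), Lemma 17.1] -/
theorem isCoprime_norm_im_star_mul {z₁ z₂ : GaussianInt} (h₁ : IsCoprime z₁ (star z₁))
    (h₁₂ : IsCoprime z₁ z₂) : IsCoprime z₁.norm (star z₁ * z₂).im := by
  -- in `ℤ[i]`: `(z₁ z̄₁, z̄₁z₂ - z₁z̄₂) = 1`
  have hA : IsCoprime z₁ (star z₁ * z₂ - z₁ * star z₂) := by
    have h := (h₁.mul_right h₁₂).add_mul_left_right (-star z₂)
    have e : star z₁ * z₂ + z₁ * -star z₂ = star z₁ * z₂ - z₁ * star z₂ := by ring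
    rwa [e] at h
  have hB : IsCoprime (star z₁) (star z₁ * z₂ - z₁ * star z₂) := by
    have h₁' : IsCoprime (star z₁) z₁ := h₁.symm
    have h₁₂' : IsCoprime (star z₁) (star z₂) := by
      simpa only [starRingEnd_apply] using h₁₂.map (starRingEnd GaussianInt)
    have h := (h₁'.mul_right h₁₂').add_mul_left_right (-z₂)
    have e : z₁ * star z₂ + star z₁ * -z₂ = -(star z₁ * z₂ - z₁ * star z₂) := by ring
    rw [e] at h
    exact (IsCoprime.neg_right_iff _ _).mp h
  have hC : IsCoprime (z₁ * star z₁) (star z₁ * z₂ - z₁ * star z₂) := hA.mul_left hB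
  rw [← Zsqrtd.norm_eq_mul_conj, star_mul_sub_mul_star] at hC
  have hD : IsCoprime ((z₁.norm : ℤ) : GaussianInt) (((2 * (star z₁ * z₂).im : ℤ) : GaussianInt)) :=
    hC.of_mul_right_left
  have hE : IsCoprime z₁.norm (2 * (star z₁ * z₂).im) := int_isCoprime_of_isCoprime_cast hD
  exact hE.of_mul_right_right

/-- Under (17.2), `(N z₁, Δ') = 1` for the odd part `Δ'` of `|Δ(z₁, z₂)|` — the hypothesis `hcop` of
`jacobiSym_norm_mul_re_star_mul`. [cite: FriedlanderIwaniecAnnals1998, (17.2), Lemma 17.1] -/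
theorem int_gcd_norm_ordCompl_im_star_mul {z₁ z₂ : GaussianInt} (h₁ : IsCoprime z₁ (star z₁))
    (h₁₂ : IsCoprime z₁ z₂) :
    Int.gcd z₁.norm ((ordCompl[2] (star z₁ * z₂).im.natAbs : ℕ) : ℤ) = 1 := by
  refine Int.isCoprime_iff_gcd_eq_one.mp ((isCoprime_norm_im_star_mul h₁ h₁₂).of_isCoprime_of_dvd_right ?_)
  exact Int.natCast_dvd.mpr (Nat.ordCompl_dvd _ 2)

/-- `(z, z̄) = 1` in `ℤ[i]` forces `(Re z, Im z) = 1` (a common divisor `g` of `r, s` divides `z` and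
`z̄`). [folklore] -/
private theorem int_gcd_re_im_of_isCoprime_star {z : GaussianInt} (h : IsCoprime z (star z)) :
    Int.gcd z.re z.im = 1 := by
  set g : ℕ := Int.gcd z.re z.im with hg
  obtain ⟨a, ha⟩ := Int.gcd_dvd_left z.re z.im
  obtain ⟨b, hb⟩ := Int.gcd_dvd_right z.re z.im
  have hz : z = ((g : ℤ) : GaussianInt) * ⟨a, b⟩ := by
    ext
    · simp only [Zsqrtd.re_mul, Zsqrtd.re_intCast, Zsqrtd.im_intCast]; rw [← hg] at ha; linarith [ha]
    · simp only [Zsqrtd.im_mul, Zsqrtd.re_intCast, Zsqrtd.im_intCast]; rw [← hg] at hb; linarith [hb]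
  have hgz : ((g : ℤ) : GaussianInt) ∣ z := ⟨_, hz⟩
  have hgz' : ((g : ℤ) : GaussianInt) ∣ star z := by
    refine ⟨(⟨a, -b⟩ : GaussianInt), ?_⟩
    rw [hz]
    ext
    · simp only [Zsqrtd.re_star, Zsqrtd.re_mul, Zsqrtd.re_intCast, Zsqrtd.im_intCast]; ring
    · simp only [Zsqrtd.im_star, Zsqrtd.im_mul, Zsqrtd.re_intCast, Zsqrtd.im_intCast]; ring
  have hu : IsUnit (((g : ℤ) : GaussianInt)) := h.isUnit_of_dvd' hgz hgz'
  have hn : (((g : ℤ) : GaussianInt)).norm = 1 := (Zsqrtd.norm_eq_one_iff' (by norm_num) _).mpr hu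
  rw [Zsqrtd.norm_intCast] at hn
  have : (g : ℤ) = 1 := by
    have hg0 : (0 : ℤ) ≤ g := by positivity
    nlinarith
  exact_mod_cast this

/-- **Lemma 17.1 under the printed hypotheses (17.2)–(17.4)** for `z₁, z₂ ∈ ℤ[i]` with odd real
parts (e.g. primary): `(z₁, z̄₁) = (z₁, z₂) = 1` and `(z₂, z̄₂) = 1` ((17.2)), `Re z₁ ≡ Re z₂ (mod 8)`
((17.3)), `Re z₁ · Re z₂ > 0` ((17.4)), and `Δ = Im z̄₁z₂ ≠ 0`; then
`(N z₁ · Re z̄₁z₂ / Δ') = (s₁/|r₁|)(s₂/|r₂|)`, i.e. (17.5) with `z₂/z₁ ≡ Re z̄₁z₂ · (N z₁)⁻¹ (mod Δ')`.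
[cite: FriedlanderIwaniecAnnals1998, Lemma 17.1] -/
theorem jacobiSym_norm_mul_re_star_mul_of_isCoprime {z₁ z₂ : GaussianInt} (hr₁ : Odd z₁.re)
    (hr₂ : Odd z₂.re) (h₁ : IsCoprime z₁ (star z₁)) (h₂ : IsCoprime z₂ (star z₂))
    (h₁₂ : IsCoprime z₁ z₂) (h8 : 8 ∣ z₁.re - z₂.re) (hpos : 0 < z₁.re * z₂.re)
    (hΔ0 : (star z₁ * z₂).im ≠ 0) :
    J(z₁.norm * (star z₁ * z₂).re | ordCompl[2] (star z₁ * z₂).im.natAbs) =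
      J(z₁.im | z₁.re.natAbs) * J(z₂.im | z₂.re.natAbs) :=
  jacobiSym_norm_mul_re_star_mul hr₁ hr₂ (int_gcd_re_im_of_isCoprime_star h₁)
    (int_gcd_re_im_of_isCoprime_star h₂) h8 hpos hΔ0 (int_gcd_norm_ordCompl_im_star_mul h₁ h₁₂)

end GaussianInt

end Literature.NumberTheory.Sieve.FriedlanderIwaniecPrimes
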